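import Mathlib
import Summits.CriticalPhenomena.CardyFormulaZ2.Theorems.CardyFlipRussoSquareFromVoronoiHubFaithfulPart3

/-!
# Stub `stub_faithful` (K1), line `Sketch` of crux `SquareFromVoronoiHub` — Part 3b:
# the squeeze for a GENERAL cell-scale schedule `ε = δ^a`

Crux `Summit.CriticalPhenomena.CardyFormulaZ2.Theses.CardyFlipRusso.SquareFromVoronoiHub`
(stmt-CriticalPhenomena-6434), line `Sketch` (card `voronoi-blocks-on-fixed-gs`), K1
("faithful discretisation": under Cardy's formula for annealed Poisson–Voronoi percolation,
`blockCrossingProb PB PW R δ (δ^a) - voronoiCrossingProb PB PW R (δ^a) → 0` as `δ → 0⁺`).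

Part 3 (`…FaithfulPart3`) proved the squeeze for the schedule `a = 1/4`.  The composition of the
line is schedule-free, and the lead RESHAPED the line (2026-08-16, cycle 2) to the schedule
`a = 1/8` — with mesh `δ = ε⁸` the bulk no-defect event only needs unweighted Poisson moment
bounds.  This file therefore records the squeeze for an ARBITRARY exponent `a > 0`:

* `tendsto_rpow_nhdsGT_of_pos` — `δ ↦ δ^a` tends to `0⁺` along `0⁺`;
* `tendsto_block_sub_voronoi_of_dual_sandwich_rpow` — the black/dual-white squeeze of Part 3 with
  `δ^a` in place of `δ^{1/4}`;
* `faithful_of_dual_sandwich_rpow` — K1 at schedule `a` from the sandwich at schedule `a`, in the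
  registered shape (hypothesis available, all Poisson pairs, all conformal rectangles);
* `faithful_of_dual_sandwich_eighth` — the instance `a = 1/8` the reshaped skeleton consumes.

(Bollobás–Riordan, *Percolation* (2006), Ch. 7, (19) with Lemma 14: limsup/liminf squeeze between
inner and outer approximating marked domains.)
-/

noncomputable section

namespace Summit.CriticalPhenomena.CardyFormulaZ2.Cruxes.SquareFromVoronoiHub.VoronoiBlocks.Faithful

open scoped Topology
open Set Filter MeasureTheory
open UpperHalfPlane (upperHalfPlaneSet)
open Literature.Analysis.FunctionSpaces (PointConfig IsPoissonPointProcess)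
open Literature.Probability.RandomPlanarGeometry (ConformalRectangle ConformalEquiv cardyFunction
  crossRatio)

/-- The schedule `δ ↦ δ^a`, `a > 0`, tends to `0⁺` as `δ → 0⁺`. [folklore] -/
theorem tendsto_rpow_nhdsGT_of_pos {a : ℝ} (ha : 0 < a) :
    Tendsto (fun δ : ℝ => δ ^ a) (𝓝[>] 0) (𝓝[>] 0) := by
  refine tendsto_nhdsWithin_iff.2 ⟨?_, ?_⟩
  · have h : Tendsto (fun δ : ℝ => δ ^ a) (𝓝 0) (𝓝 ((0 : ℝ) ^ a)) :=
      (Real.continuousAt_rpow_const 0 a (Or.inr ha.le)).tendsto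
    rw [Real.zero_rpow ha.ne'] at h
    exact h.mono_left nhdsWithin_le_nhds
  · filter_upwards [self_mem_nhdsWithin] with δ hδ
    exact Real.rpow_pos_of_pos hδ _

/-- **The black/dual-white squeeze at schedule `ε = δ^a`** (`a > 0`).  Assume Cardy's formula for
annealed Poisson–Voronoi percolation (the crux's hypothesis), a Poisson pair `PB`, `PW`, a conformal
rectangle `R` with a uniformizing datum `(φ, x)`, and the SANDWICH at schedule `a`: for every
`θ > 0`, conformal rectangles `R₁`, `R₂` with uniformizing data whose Cardy values are within `θ`
of `F(crossRatio x)` resp. `1 - F(crossRatio x)`, and, eventually as `δ → 0⁺`,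
`vor_{R₁}(δ^a) - θ ≤ block_R(δ, δ^a) ≤ 1 - vor^{white}_{R₂}(δ^a) + θ`
(`vor^{white} = voronoiCrossingProb PW PB`).  Then `block_R(δ, δ^a) - vor_R(δ^a) → 0`.
[cite: BollobasRiordan2006, Ch. 7 Lemma 14 with (19)] -/
theorem tendsto_block_sub_voronoi_of_dual_sandwich_rpow {a : ℝ} (ha : 0 < a)
    (hV : ∀ (PB PW : Measure (PointConfig ℂ)),
      IsPoissonPointProcess (volume : Measure ℂ) PB → IsPoissonPointProcess (volume : Measure ℂ) PW →
      ∀ R : ConformalRectangle, R.HasCrossingLimit (voronoiCrossingProb PB PW R) cardyFunction)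
    {PB PW : Measure (PointConfig ℂ)} (hPB : IsPoissonPointProcess (volume : Measure ℂ) PB)
    (hPW : IsPoissonPointProcess (volume : Measure ℂ) PW) (R : ConformalRectangle)
    {φ : ConformalEquiv upperHalfPlaneSet R.carrier} {x : Fin 4 → ℝ} (hx : R.IsUniformizing φ x)
    (hsand : ∀ θ : ℝ, 0 < θ → ∃ (R₁ R₂ : ConformalRectangle)
        (φ₁ : ConformalEquiv upperHalfPlaneSet R₁.carrier) (x₁ : Fin 4 → ℝ)
        (φ₂ : ConformalEquiv upperHalfPlaneSet R₂.carrier) (x₂ : Fin 4 → ℝ),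
        R₁.IsUniformizing φ₁ x₁ ∧ R₂.IsUniformizing φ₂ x₂ ∧
        |cardyFunction (crossRatio x₁) - cardyFunction (crossRatio x)| ≤ θ ∧
        |(1 - cardyFunction (crossRatio x₂)) - cardyFunction (crossRatio x)| ≤ θ ∧
        ∀ᶠ δ in 𝓝[>] (0 : ℝ),
          voronoiCrossingProb PB PW R₁ (δ ^ a) - θ ≤ blockCrossingProb PB PW R δ (δ ^ a) ∧
          blockCrossingProb PB PW R δ (δ ^ a) ≤ 1 - voronoiCrossingProb PW PB R₂ (δ ^ a) + θ) :
    Tendsto (fun δ : ℝ => blockCrossingProb PB PW R δ (δ ^ a) -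
        voronoiCrossingProb PB PW R (δ ^ a)) (𝓝[>] 0) (𝓝 0) := by
  refine tendsto_sub_of_squeeze ((hV PB PW hPB hPW R φ x hx).comp (tendsto_rpow_nhdsGT_of_pos ha))
    fun θ hθ => ?_
  obtain ⟨R₁, R₂, φ₁, x₁, φ₂, x₂, hx₁, hx₂, hc₁, hc₂, hev⟩ := hsand θ hθ
  refine ⟨_, fun δ => 1 - voronoiCrossingProb PW PB R₂ (δ ^ a), _, _,
    (hV PB PW hPB hPW R₁ φ₁ x₁ hx₁).comp (tendsto_rpow_nhdsGT_of_pos ha),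
    tendsto_const_nhds.sub ((hV PW PB hPW hPB R₂ φ₂ x₂ hx₂).comp (tendsto_rpow_nhdsGT_of_pos ha)),
    hc₁, hc₂, hev⟩

/-- **K1 at schedule `ε = δ^a` from the black/dual-white sandwich at schedule `a`, in the registered
shape** (Cardy-value closeness asked against EVERY uniformizing datum of `R`; data exist by
`MarkedDomain.exists_isUniformizing_holds`). [cite: BollobasRiordan2006, Ch. 7 Lemma 14 with (19)] -/
theorem faithful_of_dual_sandwich_rpow {a : ℝ} (ha : 0 < a)
    (hS : ∀ (PB PW : Measure (PointConfig ℂ)),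
      IsPoissonPointProcess (volume : Measure ℂ) PB → IsPoissonPointProcess (volume : Measure ℂ) PW →
      ∀ (R : ConformalRectangle) (θ : ℝ), 0 < θ → ∃ (R₁ R₂ : ConformalRectangle)
        (φ₁ : ConformalEquiv upperHalfPlaneSet R₁.carrier) (x₁ : Fin 4 → ℝ)
        (φ₂ : ConformalEquiv upperHalfPlaneSet R₂.carrier) (x₂ : Fin 4 → ℝ),
        R₁.IsUniformizing φ₁ x₁ ∧ R₂.IsUniformizing φ₂ x₂ ∧
        (∀ (φ : ConformalEquiv upperHalfPlaneSet R.carrier) (x : Fin 4 → ℝ), R.IsUniformizing φ x →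
          |cardyFunction (crossRatio x₁) - cardyFunction (crossRatio x)| ≤ θ ∧
          |(1 - cardyFunction (crossRatio x₂)) - cardyFunction (crossRatio x)| ≤ θ) ∧
        ∀ᶠ δ in 𝓝[>] (0 : ℝ),
          voronoiCrossingProb PB PW R₁ (δ ^ a) - θ ≤ blockCrossingProb PB PW R δ (δ ^ a) ∧
          blockCrossingProb PB PW R δ (δ ^ a) ≤ 1 - voronoiCrossingProb PW PB R₂ (δ ^ a) + θ) :
    (∀ (PB PW : Measure (PointConfig ℂ)),
      IsPoissonPointProcess (volume : Measure ℂ) PB → IsPoissonPointProcess (volume : Measure ℂ) PW →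
      ∀ R : ConformalRectangle, R.HasCrossingLimit (voronoiCrossingProb PB PW R) cardyFunction) →
    ∀ (PB PW : Measure (PointConfig ℂ)),
      IsPoissonPointProcess (volume : Measure ℂ) PB → IsPoissonPointProcess (volume : Measure ℂ) PW →
      ∀ R : ConformalRectangle,
        Tendsto (fun δ : ℝ => blockCrossingProb PB PW R δ (δ ^ a) -
            voronoiCrossingProb PB PW R (δ ^ a)) (𝓝[>] 0) (𝓝 0) := by
  intro hV PB PW hPB hPW R
  obtain ⟨φ, x, hx⟩ :=
    (Literature.Probability.RandomPlanarGeometry.MarkedDomain.exists_isUniformizing_holds (n := 4)) R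
  refine tendsto_block_sub_voronoi_of_dual_sandwich_rpow ha hV hPB hPW R hx fun θ hθ => ?_
  obtain ⟨R₁, R₂, φ₁, x₁, φ₂, x₂, hx₁, hx₂, hc, hev⟩ := hS PB PW hPB hPW R θ hθ
  exact ⟨R₁, R₂, φ₁, x₁, φ₂, x₂, hx₁, hx₂, (hc φ x hx).1, (hc φ x hx).2, hev⟩

/-- **K1 at the reshaped schedule `ε = δ^{1/8}` from its sandwich** — the instance `a = 1/8` of
`faithful_of_dual_sandwich_rpow`, stated with the literal exponent `δ ^ (1 / 8 : ℝ)` that the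
line's reshaped skeleton registers. [cite: BollobasRiordan2006, Ch. 7 Lemma 14 with (19)] -/
theorem faithful_of_dual_sandwich_eighth
    (hS : ∀ (PB PW : Measure (PointConfig ℂ)),
      IsPoissonPointProcess (volume : Measure ℂ) PB → IsPoissonPointProcess (volume : Measure ℂ) PW →
      ∀ (R : ConformalRectangle) (θ : ℝ), 0 < θ → ∃ (R₁ R₂ : ConformalRectangle)
        (φ₁ : ConformalEquiv upperHalfPlaneSet R₁.carrier) (x₁ : Fin 4 → ℝ)
        (φ₂ : ConformalEquiv upperHalfPlaneSet R₂.carrier) (x₂ : Fin 4 → ℝ),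
        R₁.IsUniformizing φ₁ x₁ ∧ R₂.IsUniformizing φ₂ x₂ ∧
        (∀ (φ : ConformalEquiv upperHalfPlaneSet R.carrier) (x : Fin 4 → ℝ), R.IsUniformizing φ x →
          |cardyFunction (crossRatio x₁) - cardyFunction (crossRatio x)| ≤ θ ∧
          |(1 - cardyFunction (crossRatio x₂)) - cardyFunction (crossRatio x)| ≤ θ) ∧
        ∀ᶠ δ in 𝓝[>] (0 : ℝ),
          voronoiCrossingProb PB PW R₁ (δ ^ (1 / 8 : ℝ)) - θ ≤
              blockCrossingProb PB PW R δ (δ ^ (1 / 8 : ℝ)) ∧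
            blockCrossingProb PB PW R δ (δ ^ (1 / 8 : ℝ)) ≤
              1 - voronoiCrossingProb PW PB R₂ (δ ^ (1 / 8 : ℝ)) + θ) :
    (∀ (PB PW : Measure (PointConfig ℂ)),
      IsPoissonPointProcess (volume : Measure ℂ) PB → IsPoissonPointProcess (volume : Measure ℂ) PW →
      ∀ R : ConformalRectangle, R.HasCrossingLimit (voronoiCrossingProb PB PW R) cardyFunction) →
    ∀ (PB PW : Measure (PointConfig ℂ)),
      IsPoissonPointProcess (volume : Measure ℂ) PB → IsPoissonPointProcess (volume : Measure ℂ) PW →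
      ∀ R : ConformalRectangle,
        Tendsto (fun δ : ℝ => blockCrossingProb PB PW R δ (δ ^ (1 / 8 : ℝ)) -
            voronoiCrossingProb PB PW R (δ ^ (1 / 8 : ℝ))) (𝓝[>] 0) (𝓝 0) :=
  faithful_of_dual_sandwich_rpow (a := 1 / 8) (by norm_num) hS


/-- **Registered sub-goal `stub_faithful_squeeze_eighth`** of the reshaped K1 (schedule
`ε = δ^{1/8}`): K1 at schedule `1/8` in its registered shape, from the black/dual-white sandwich at
schedule `1/8`, by the squeeze against the hypothesis on `R`, `R₁`, `R₂`.
[cite: BollobasRiordan2006, Ch. 7 Lemma 14 with (19)] -/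
theorem stub_faithful_squeeze_eighth : (∀ (PB PW : Measure (PointConfig ℂ)), IsPoissonPointProcess (volume : Measure ℂ) PB → IsPoissonPointProcess (volume : Measure ℂ) PW → ∀ (R : ConformalRectangle) (θ : ℝ), 0 < θ → ∃ (R₁ R₂ : ConformalRectangle) (φ₁ : Literature.Probability.RandomPlanarGeometry.ConformalEquiv UpperHalfPlane.upperHalfPlaneSet R₁.carrier) (x₁ : Fin 4 → ℝ) (φ₂ : Literature.Probability.RandomPlanarGeometry.ConformalEquiv UpperHalfPlane.upperHalfPlaneSet R₂.carrier) (x₂ : Fin 4 → ℝ), R₁.IsUniformizing φ₁ x₁ ∧ R₂.IsUniformizing φ₂ x₂ ∧ (∀ (φ : Literature.Probability.RandomPlanarGeometry.ConformalEquiv UpperHalfPlane.upperHalfPlaneSet R.carrier) (x : Fin 4 → ℝ), R.IsUniformizing φ x → |cardyFunction (crossRatio x₁) - cardyFunction (crossRatio x)| ≤ θ ∧ |(1 - cardyFunction (crossRatio x₂)) - cardyFunction (crossRatio x)| ≤ θ) ∧ ∀ᶠ δ in 𝓝[>] (0 : ℝ), voronoiCrossingProb PB PW R₁ (δ ^ (1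 / 8 : ℝ)) - θ ≤ blockCrossingProb PB PW R δ (δ ^ (1 / 8 : ℝ)) ∧ blockCrossingProb PB PW R δ (δ ^ (1 / 8 : ℝ)) ≤ 1 - voronoiCrossingProb PW PB R₂ (δ ^ (1 / 8 : ℝ)) + θ) → (∀ (PB PW : Measure (PointConfig ℂ)), IsPoissonPointProcess (volume : Measure ℂ) PB → IsPoissonPointProcess (volume : Measure ℂ) PW → ∀ R : ConformalRectangle, R.HasCrossingLimit (voronoiCrossingProb PB PW R) cardyFunction) → ∀ (PB PW : Measure (PointConfig ℂ)), IsPoissonPointProcess (volume : Measure ℂ) PB → IsPoissonPointProcess (volume : Measure ℂ) PW → ∀ R : ConformalRectangle, Tendsto (fun δ : ℝ => blockCrossingProb PB PW R δ (δ ^ (1 / 8 : ℝ)) - voronoiCrossingProb PB PW R (δ ^ (1 / 8 : ℝ))) (𝓝[>] 0) (𝓝 0) :=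
  fun hS => faithful_of_dual_sandwich_eighth hS

end Summit.CriticalPhenomena.CardyFormulaZ2.Cruxes.SquareFromVoronoiHub.VoronoiBlocks.Faithful

end
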